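import Summits.ValiantsHypothesis.ValiantsHypothesis.Theses.FreeEnergyLift

/-!
# ValiantsHypothesis / FreeEnergyLift — item `TransferGivesSpanningTreeLift` (stmt-ValiantsHypothesis-5607)

`FreeEnergyLiftTransfer → isVPFamily_stPoly → SpanningTreeFreeEnergyLift`: instantiate the transfer
`H1` at the Jerrum–Snir spanning-tree (arborescence) family `N ↦ ST_N` over `ℝ≥0`
(`Literature.Barriers.ValiantsHypothesis.stPoly`; its images over `ℂ` and `ℝ` are `stPoly ℂ N`,
`stPoly ℝ N` by `map_stPoly`), which is a `VP` family over `ℂ` by the cone fact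
`isVPFamily_stPoly`. HONEST FRAMING: glue of a dormant route; nothing here is progress on
`VP ≠ VNP`.
-/

-- layout Summits/ValiantsHypothesis/ValiantsHypothesis forces the duplicated namespace component
set_option linter.dupNamespace false

namespace Summit.ValiantsHypothesis.ValiantsHypothesis.Theorems.FreeEnergyLift

open Literature.Computability.AlgebraicComplexity Literature.Barriers.ValiantsHypothesis MvPolynomial

/-- **Item `TransferGivesSpanningTreeLift` (stmt-ValiantsHypothesis-5607):**
`FreeEnergyLiftTransfer → isVPFamily_stPoly → SpanningTreeFreeEnergyLift`. [folklore] -/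
theorem transferGivesSpanningTreeLift_proof : Theses.FreeEnergyLift.TransferGivesSpanningTreeLift := by
  unfold Theses.FreeEnergyLift.TransferGivesSpanningTreeLift Theses.FreeEnergyLift.FreeEnergyLiftTransfer
    Theses.FreeEnergyLift.SpanningTreeFreeEnergyLift
  intro hT hST
  have hmapC : (fun N => MvPolynomial.map ((algebraMap ℝ ℂ).comp NNReal.toRealHom) (stPoly NNReal N)) =
      fun N => stPoly ℂ N := by
    funext N; exact map_stPoly _ N
  have hVP : IsVPFamily (k := ℂ) (fun N => MvPolynomial.map ((algebraMap ℝ ℂ).comp NNReal.toRealHom)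
      (stPoly NNReal N)) := by
    rw [hmapC]; exact hST ℂ
  obtain ⟨c, hc⟩ := hT (fun N => Fin N × Option (Fin N)) (fun N => stPoly NNReal N) hVP
  refine ⟨c, fun N => ?_⟩
  obtain ⟨k, m, p, A, b, hsize, hlift⟩ := hc N
  rw [map_stPoly] at hlift
  exact ⟨k, m, p, A, b, hsize, hlift⟩

end Summit.ValiantsHypothesis.ValiantsHypothesis.Theorems.FreeEnergyLift
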